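import Literature.Algebra.Lie.SpecialLinearKilling
import Literature.Algebra.Lie.CompactKillingForm
import Literature.Algebra.Lie.SpecialLinearSimple
import Literature.Algebra.Lie.SpecialUnitarySimple
import Literature.MathematicalPhysics.QuantumFieldTheory.Balaban1983to89.B10
import Literature.MathematicalPhysics.QuantumFieldTheory.Balaban1983to89.B12Semisimple414
import Literature.MathematicalPhysics.QuantumFieldTheory.Balaban1983to89.B13DerivZeroGauge
import Literature.MathematicalPhysics.QuantumFieldTheory.Balaban1983to89.B10Eq32SuN
import Literature.MathematicalPhysics.QuantumFieldTheory.Balaban1983to89.B12Schur433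
import HarnessLib

/-!
# `Balaban1983to89.B12SemisimpleSuN` — «We assume that G is semisimple … for example G ⊂ U(N)» ([Balaban1987RG1]
# pp. 251–252) AT PRINT'S EXAMPLE `G = SU(N)`: the cell's instance hypotheses `[LieAlgebra.IsSemisimple ℝ 𝔤]`,
# `[LieAlgebra.IsSemisimple ℂ 𝔥]`, `[LieAlgebra.IsKilling ℝ 𝔤] (hdef : κ(x,x) < 0)` DISCHARGED for `𝔤 = 𝔰𝔲(N)`,
# `𝔤ᶜ = 𝔰𝔩(N, ℂ)` — (32) of [Balaban1985UV3], (4.13) ⇒ (4.14) of [Balaban1987RG1], the detecting span of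
# `B13DerivZeroGauge` §3, the perfectness input of `B12Semisimple414` §5, with NO instance hypothesis left

statement-level skeleton of published theorems with citation tags; proofs where landed; nothing here is a claim about the Yang–Mills mass gap

Unit `lit-balaban-p24` gen 7 (Phase-2 proof seat; HOME `run/shared/lean/pub/lit-balaban/`, seat dir `lit-balaban-p24/`),
companion of the Algebra support files `Literature/Algebra/Lie/SpecialLinearSimple.lean` (p261260: `𝔰𝔩(n, K)` simple),
`Literature/Algebra/Lie/SpecialUnitarySimple.lean` (p292822: `𝔰𝔲(n)` simple, [Hall2015] Prop. 7.31), `Literature/Algebra/Lie/SpecialLinearKilling.lean` (p260330: `𝔰𝔩(n, K)` is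
Killing and semisimple in characteristic 0, `κ = 2|n|·Tr(XY)` — [Humphreys1972] §5.1/§6 Ex. 7) and
`Literature/Algebra/Lie/CompactKillingForm.lean` (p260620: a real Lie algebra with an `ad`-invariant inner product and
trivial centre has NEGATIVE-DEFINITE Killing form and is semisimple; `𝔰𝔲(n)`, every `𝔤 ≤ 𝔲(n)` with `Z(𝔤) = 0` —
[BrockerTomDieck1985] V (5.13), [Hall2015] §7.1).  PDF held: `paper:balaban1987-cmp109-rg-i-small-field`
([Balaban1987RG1] = B12, journal page = PDF page + 248), `paper:balaban1985-cmp102-uv-stability-3d` ([Balaban1985UV3] =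
B10, journal page = PDF page + 254), `paper:balaban1988-cmp116-rg-ii-cluster` ([Balaban1988RG2Cluster] = B13).

WHAT IS REPRODUCED: the STANDING HYPOTHESIS of [Balaban1987RG1] pp. 251–252 *«Field configurations have values in a
compact Lie group G. … We assume that G is semisimple and that it is a Lie subgroup of a group of complex unitary
matrices, for example G ⊂ U(N).»* and its two printed uses — [Balaban1985UV3] (32) p. 264 *«by the assumption that 𝔤 is
semi-simple, the only element invariant is 0 … It is the only place we use the semi-simplicity»* (SKELETON row
**B10.Eq32**, file of record `B10.invariant_vector_eq_zero`, abstract `[LieAlgebra.IsSemisimple R L]`) and [Balaban1987RG1]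
(4.13) ⇒ (4.14) p. 284 *«The group G is semisimple, hence this is possible only for the element 0 in the algebra 𝐠ᶜ»*
(rows **B12.Eq4.13-4.14**, files of record `B12Decay510R1.eq_zero_of_forall_lie_eq_zero`, `B12Ward414.span_range_adConst_…`,
`B12Semisimple414.span_commutatorSet_eq_top_of_isSemisimple`, `B13DerivZeroGauge.lieSubalgebra_le_span_comm` /
`dense_span_range_of_conj_adConst_of_span`, all abstract in a semisimple `𝔤`) — AT THE PRINTED EXAMPLE `G = SU(N)`:
`𝔤 = 𝔰𝔲(N)` = `Literature.Algebra.Lie.CompactKillingForm.su (Fin N)` (traceless skew-Hermitian, real Lie subalgebra of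
`M_N(ℂ)`), `𝔤ᶜ = 𝔰𝔩(N, ℂ)` = Mathlib `LieAlgebra.SpecialLinear.sl (Fin N) ℂ`.  `B10Eq32SuN` (b10 gen 22) HONEST SCOPE
(iv) recorded «semisimplicity of 𝔰𝔩_N, N ≥ 2, which is not available in Mathlib and not proved here» and BYPASSED the
abstract §3 there by matrix units; with p260330/p260620 the instances exist, and this file exercises the abstract theorems
of record at the example, each in ONE line (kind «model-instance»; the files of record are used BY NAME and untouched).

WHAT IS PROVED (theorems only; no definition, no named fact, no `sorry`):
* §1 the instances resolve: `isSemisimple_su`, `isKilling_su`, `isSemisimple_sl`, `isKilling_sl` (any finite index type),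
  `killingForm_su_neg` (the `hdef` shape of `B12Schur433`: `κ(x, x) < 0` for `x ≠ 0`), `center_su`, `center_sl`.
* §2 (32) at `G = SU(N)`: `invariant_vector_eq_zero_su` / `_sl` (= `B10.invariant_vector_eq_zero`).
* §3 (4.13) ⇒ (4.14) at `𝐠ᶜ = 𝔰𝔩(N, ℂ)`: `eq_zero_of_forall_lie_eq_zero_sl` (= `B12Decay510R1.…`); the detecting span
  `span_range_adConst_eq_top_sl` / `_su` (= `B12Ward414.span_range_adConst_eq_top_of_isKilling`) and its dense/conjugated
  form `dense_span_range_of_conj_adConst_sl` (= `B13DerivZeroGauge.dense_span_range_of_conj_adConst_of_span`).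
* §4 `[𝔤ᶜ, M_N(ℂ)] ⊇ 𝔤ᶜ`: `traceless_mem_span_comm` — every traceless matrix lies in `span_ℂ {λ_l·y − y·λ_l}` for ANY
  family `λ` spanning `𝔰𝔩_N` over ℂ (= `B13DerivZeroGauge.lieSubalgebra_le_span_comm` at `𝔥 = 𝔰𝔩_N`; compare
  `B10Eq32SuN.span_suComm_eq_ker_trace`, the same containment by matrix units for `λ` ranging over `𝔰𝔲(N)`).
* §5 PERFECTNESS `[𝔰𝔲(N), 𝔰𝔲(N)]` spans `𝔰𝔲(N)`: `span_commutatorSet_su_eq_top` (= `B12Semisimple414.span_commutatorSet_eq_top_of_isSemisimple`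
  at `𝔤 = V = 𝔰𝔲(N)`, `𝔄 = M_N(ℂ)`, `ρ` = inclusion).
* §6 THE SCHUR STEP p. 289, `N ≥ 2`: `exists_eq_mul_killingForm_sl` — every `ad`-invariant bilinear form on `𝔰𝔩(N, ℂ)` is a
  multiple of the Killing form (= `B12Schur433.exists_eq_mul_killingForm_of_isAlgClosed` with `[IsSimple]` from `SpecialLinearSimple`
  and `[IsKilling]` from `SpecialLinearKilling`); the real form AT `G = SU(N)` (v1.1): `exists_eq_mul_killingForm_su`,
  `centroid_eq_smul_su` (= `B12Schur433.exists_eq_mul_killingForm_of_killing_neg` / `exists_eq_smul_of_centroid_of_killing_neg`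
  with `[IsSimple ℝ 𝔰𝔲(N)]` from `SpecialUnitarySimple.isSimple_su`, `[IsKilling]` + `hdef` from `CompactKillingForm`; the `hcen`
  binder of `B12Schur433.hessian_chart_eq_sum_scalar_kernel_killing`).
* §7 `B10Eq32SuN` §3 AT `𝔥 = 𝔰𝔩(N, ℂ)`: `logHalfBound_expLine_of_sl` (= `B10Eq32SuN.logHalfBound_expLine_of_semisimple`, real
  background, `G`-form, with `𝔥 := sl (Fin N) ℂ` under the lineage's `cstarAlgebraMatrix N`; the two complex-background
  §3 theorems instantiate the same way and are not restated).
v1.2 (citeloc only, pub-balaban summit-lit1 P-lit1-g28-1): the display (4.34) OPENS on p. 289 («Let us write the result of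
the preceding analysis (4.6) = Σ …», last lines) and carries its label on p. 290 (PDF p. 42 l. 5), so the three locators
«(4.32)–(4.34) p.289» / «(4.33)–(4.34) p.289» of §6 now read «pp.289–290»; (4.32), (4.33) and the Schur sentence are on
p. 289 as before; declarations byte-identical.
HONEST SCOPE: (i) `G = SU(N)` only (print: any compact semisimple `G ⊂ U(N)`; for a general `𝔤 ≤ 𝔲(N)` with `Z(𝔤) = 0`
use `CompactKillingForm.isSemisimple_of_le_unitaryLie` in the same one-liners; the Schur step §6 needs SIMPLE `G`, as
`B12Schur433` §3 shows by its product counterexample); (ii) nothing of B10/B12/B13 is asserted; no SKELETON head changes by this file (owners r07 / r09·r20 / r10 annotate cells B10.Eq32, B12.Eq4.13-4.14,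
B12.Eq4.32-4.33, B13.Gauge).
-/

namespace Literature.MathematicalPhysics.QuantumFieldTheory.Balaban1983to89.B12SemisimpleSuN

open LieAlgebra.SpecialLinear (sl)
open Literature.Algebra.Lie.CompactKillingForm (su unitaryLie su_le_unitaryLie center_su_eq_bot
  killingForm_su_apply_self_neg)
open Literature.Algebra.Lie.SpecialLinearKilling (center_sl_eq_bot)

variable (n : Type*) [Fintype n] [DecidableEq n]

/-! ## §1 The instances resolve at print's example `𝔤 = 𝔰𝔲(N)`, `𝔤ᶜ = 𝔰𝔩(N, ℂ)` -/

/-- `𝔰𝔲(N)` is semisimple (instance of `CompactKillingForm`, found by `inferInstance`).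
[cite: Balaban1987RG1, pp.251–252 («We assume that G is semisimple … for example G ⊂ U(N)»)] -/
theorem isSemisimple_su : LieAlgebra.IsSemisimple ℝ (su n) := inferInstance

/-- `𝔰𝔲(N)` is Killing (non-degenerate Killing form). [cite: Balaban1987RG1, pp.251–252] -/
theorem isKilling_su : LieAlgebra.IsKilling ℝ (su n) := inferInstance

/-- `𝔰𝔩(N, ℂ) = 𝔰𝔲(N)ᶜ` is semisimple (instance of `SpecialLinearKilling`). [cite: Balaban1987RG1, p.252 («𝔤ᶜ denotes the
complexification of 𝔤»), p.284 («the algebra 𝐠ᶜ»)] -/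
theorem isSemisimple_sl : LieAlgebra.IsSemisimple ℂ (sl n ℂ) := inferInstance

/-- `𝔰𝔩(N, ℂ)` is Killing. [cite: Balaban1987RG1, p.252, p.284] -/
theorem isKilling_sl : LieAlgebra.IsKilling ℂ (sl n ℂ) := inferInstance

variable {n} in
/-- The `hdef` binder of `B12Schur433` at `𝔤 = 𝔰𝔲(N)`: the Killing form is NEGATIVE DEFINITE.
[cite: Balaban1987RG1, pp.251–252, (4.32)–(4.33) p.289] -/
theorem killingForm_su_neg {X : su n} (hX : X ≠ 0) : killingForm ℝ (su n) X X < 0 :=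
  killingForm_su_apply_self_neg hX

/-- `Z(𝔰𝔲(N)) = 0`. [cite: Balaban1987RG1, pp.251–252] -/
theorem center_su : LieAlgebra.center ℝ (su n) = ⊥ := center_su_eq_bot n

/-- `Z(𝔰𝔩(N, ℂ)) = 0`. [cite: Balaban1987RG1, p.284] -/
theorem center_sl : LieAlgebra.center ℂ (sl n ℂ) = ⊥ := center_sl_eq_bot n ℂ

/-! ## §2 [Balaban1985UV3] (32) «the only element invariant is 0» at `G = SU(N)` -/

variable {n} in
/-- **(32) for `𝔤 = 𝔰𝔲(N)`**: an element of `𝔰𝔲(N)` annihilated by every `ad x`, `x ∈ 𝔰𝔲(N)`, is `0`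
(`B10.invariant_vector_eq_zero`, instance supplied). [cite: Balaban1985UV3, (31)–(32) p.264] -/
theorem invariant_vector_eq_zero_su (v : su n) (h : ∀ x : su n, ⁅x, v⁆ = 0) : v = 0 :=
  B10.invariant_vector_eq_zero (R := ℝ) v h

variable {n} in
/-- **(32) for `𝔤ᶜ = 𝔰𝔩(N, ℂ)`**. [cite: Balaban1985UV3, (31)–(32) p.264] -/
theorem invariant_vector_eq_zero_sl (v : sl n ℂ) (h : ∀ x : sl n ℂ, ⁅x, v⁆ = 0) : v = 0 :=
  B10.invariant_vector_eq_zero (R := ℂ) v h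

/-! ## §3 [Balaban1987RG1] (4.13) ⇒ (4.14) and the detecting span at `𝐠ᶜ = 𝔰𝔩(N, ℂ)` -/

variable {n} in
/-- **(4.13) ⇒ (4.14) at `𝐠ᶜ = 𝔰𝔩(N, ℂ)`**: a `𝔰𝔩(N, ℂ)`-valued function on the bonds commuting with every constant
`λ` vanishes (`B12Decay510R1.eq_zero_of_forall_lie_eq_zero`, instance supplied). [cite: Balaban1987RG1, (4.13)-(4.14) p.284] -/
theorem eq_zero_of_forall_lie_eq_zero_sl {β : Type*} (z : β → sl n ℂ) (h : ∀ (l : sl n ℂ) (b : β), ⁅l, z b⁆ = 0) :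
    z = 0 :=
  B12Decay510R1.eq_zero_of_forall_lie_eq_zero (R := ℂ) z h

variable {n} in
/-- The Ward detecting property at `𝐠ᶜ = 𝔰𝔩(N, ℂ)`: the ranges of the `ad_λ`, `λ ∈ 𝔰𝔩(N, ℂ)`, acting bond by bond,
SPAN the configuration space `ι → 𝔰𝔩(N, ℂ)` (`B12Ward414.span_range_adConst_eq_top_of_isKilling`).
[cite: Balaban1987RG1, (4.13)-(4.14) p.284] -/
theorem span_range_adConst_eq_top_sl {ι : Type*} [Fintype ι] [DecidableEq ι] :
    Submodule.span ℂ (⋃ l : sl n ℂ, Set.range (B12Ward414.adConst (K := ℂ) (ι := ι) l)) = ⊤ :=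
  B12Ward414.span_range_adConst_eq_top_of_isKilling

variable {n} in
/-- The same over `ℝ` for `𝔤 = 𝔰𝔲(N)`. [cite: Balaban1987RG1, (4.13)-(4.14) p.284] -/
theorem span_range_adConst_eq_top_su {ι : Type*} [Fintype ι] [DecidableEq ι] :
    Submodule.span ℝ (⋃ l : su n, Set.range (B12Ward414.adConst (K := ℝ) (ι := ι) l)) = ⊤ :=
  B12Ward414.span_range_adConst_eq_top_of_isKilling

variable {n} in
/-- `B13DerivZeroGauge.dense_span_range_of_conj_adConst_of_span` at `𝔤 = 𝔰𝔩(N, ℂ)`: for any complex normed configuration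
space `V` identified with `ι → 𝔰𝔩(N, ℂ)` so that the generators `L l` act as `ad_{λ_l}` variable-wise, `λ` spanning
`𝔰𝔩(N, ℂ)`, the ranges of the `L l` span a dense subspace. [cite: Balaban1985UV3, (31)–(32) p.264; Balaban1987RG1, (4.13)–(4.14) p.284] -/
theorem dense_span_range_of_conj_adConst_sl {V : Type*} [NormedAddCommGroup V] [NormedSpace ℂ V]
    {ι : Type*} [Fintype ι] [DecidableEq ι] (e : V ≃ₗ[ℂ] (ι → sl n ℂ)) {Λ : Type*} (lam : Λ → sl n ℂ)
    (hlam : Submodule.span ℂ (Set.range lam) = ⊤) (L : Λ → V →L[ℂ] V)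
    (hconj : ∀ l v, e (L l v) = B12Ward414.adConst (K := ℂ) (lam l) (e v)) :
    Dense (Submodule.span ℂ (⋃ l, Set.range (L l)) : Set V) :=
  B13DerivZeroGauge.dense_span_range_of_conj_adConst_of_span e lam hlam L hconj

/-! ## §4 `[𝔤ᶜ, M_N(ℂ)] ⊇ 𝔤ᶜ` at `𝔥 = 𝔰𝔩(N, ℂ) ⊂ M_N(ℂ)` -/

variable {n} in
/-- **Every traceless matrix is in the ℂ-span of the commutators `λ_l·y − y·λ_l`**, for ANY family `λ` spanning
`𝔰𝔩(N, ℂ)` over ℂ (e.g. a basis of the real form `𝔰𝔲(N)` — «R(U), U ∈ G») — `B13DerivZeroGauge.lieSubalgebra_le_span_comm`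
at `𝔥 = 𝔰𝔩(N, ℂ)`, instance supplied (the b10 lineage obtained this containment by matrix units,
`B10Eq32SuN.span_suComm_eq_ker_trace`). [cite: Balaban1985UV3, (31)–(32) p.264; Balaban1987RG1, p.283] -/
theorem traceless_mem_span_comm {Λ : Type*} (lam : Λ → sl n ℂ) (hlam : Submodule.span ℂ (Set.range lam) = ⊤)
    {z : Matrix n n ℂ} (hz : z.trace = 0) :
    z ∈ Submodule.span ℂ {c : Matrix n n ℂ | ∃ l y, c = (lam l : Matrix n n ℂ) * y - y * (lam l : Matrix n n ℂ)} :=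
  B13DerivZeroGauge.lieSubalgebra_le_span_comm (sl n ℂ) lam hlam hz

/-! ## §5 Perfectness of `𝔰𝔲(N)` (the `hspan` input of `B12Semisimple414` §§3–4 at `𝔤 = V = 𝔰𝔲(N)`) -/

/-- **`[𝔰𝔲(N), 𝔰𝔲(N)]` spans `𝔰𝔲(N)`**: the elements `c ∈ 𝔰𝔲(N)` that are matrix commutators `l·v − v·l` of elements of
`𝔰𝔲(N)` span `𝔰𝔲(N)` over ℝ — `B12Semisimple414.span_commutatorSet_eq_top_of_isSemisimple` with `V = 𝔤 = 𝔰𝔲(N)`,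
`eV = id`, `ρ` the inclusion into `𝔄 = M_N(ℂ)`, instance supplied. [cite: Balaban1987RG1, (4.13)-(4.14) p.284] -/
theorem span_commutatorSet_su_eq_top :
    Submodule.span ℝ {c : su n | ∃ l v : su n,
      (c : Matrix n n ℂ) = (l : Matrix n n ℂ) * (v : Matrix n n ℂ) - (v : Matrix n n ℂ) * (l : Matrix n n ℂ)} = ⊤ :=
  -- `eV = refl`, `ρ = (↑)`: the compatibility `↑⁅a, b⁆ = a·b − b·a` holds by `rfl` (the bracket of `M_N(ℂ)` carried
  -- inside the type of `su n` is the ring commutator).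
  B12Semisimple414.span_commutatorSet_eq_top_of_isSemisimple (LinearEquiv.refl ℝ (su n))
    (fun x : su n => (x : Matrix n n ℂ)) fun _ _ => rfl

/-! ## §6 The SCHUR STEP of [Balaban1987RG1] p. 289 («𝐄_ab = 𝐄δ_ab») AT `𝔤ᶜ = 𝔰𝔩(N, ℂ)` and (v1.1) AT `G = SU(N)`:
invariant forms on `𝔰𝔩(N, ℂ)` / `𝔰𝔲(N)` are multiples of the Killing form (`B12Schur433`, instances + `hdef` supplied) -/

section Schur

open Literature.Algebra.Lie.SpecialLinearSimple (isSimple_sl_of_charZero)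
open Literature.Algebra.Lie.SpecialUnitarySimple (isSimple_su)

variable {n}

/-- **Every `ad`-invariant bilinear form on `𝔰𝔩(N, ℂ)`, `N ≥ 2`, is a multiple of the Killing form** — print's *«With our
assumptions on the group G the identity (4.33) holds for 𝐄 if and only if 𝐄_ab is proportional to the identity matrix,
𝐄_ab = 𝐄δ_ab»* read on `𝔤ᶜ`: `B12Schur433.exists_eq_mul_killingForm_of_isAlgClosed` with `[IsSimple ℂ 𝔰𝔩(N,ℂ)]`
(`SpecialLinearSimple`) and `[IsKilling ℂ 𝔰𝔩(N,ℂ)]` (`SpecialLinearKilling`) supplied. [cite: Balaban1987RG1, (4.32)–(4.34) pp.289–290] -/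
theorem exists_eq_mul_killingForm_sl (hN : 1 < Fintype.card n) (Φ : LinearMap.BilinForm ℂ (sl n ℂ))
    (hΦ : Φ.lieInvariant (sl n ℂ)) : ∃ c : ℂ, ∀ x y : sl n ℂ, Φ x y = c * killingForm ℂ (sl n ℂ) x y :=
  haveI := isSimple_sl_of_charZero n ℂ hN
  B12Schur433.exists_eq_mul_killingForm_of_isAlgClosed Φ hΦ

/-- **Every `ad`-invariant bilinear form on `𝔰𝔲(N)`, `N ≥ 2`, is a multiple of the Killing form** (v1.1) — print's
*«With our assumptions on the group G the identity (4.33) holds for 𝐄 if and only if 𝐄_ab is proportional to the identity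
matrix, 𝐄_ab = 𝐄δ_ab»* at the example `G = SU(N)`: `B12Schur433.exists_eq_mul_killingForm_of_killing_neg` with
`[IsSimple ℝ 𝔰𝔲(N)]` (`SpecialUnitarySimple.isSimple_su`), `[IsKilling ℝ 𝔰𝔲(N)]` and `hdef` (`CompactKillingForm`)
supplied. [cite: Balaban1987RG1, (4.32)–(4.34) pp.289–290] -/
theorem exists_eq_mul_killingForm_su (hN : 1 < Fintype.card n) (Φ : LinearMap.BilinForm ℝ (su n))
    (hΦ : Φ.lieInvariant (su n)) : ∃ c : ℝ, ∀ x y : su n, Φ x y = c * killingForm ℝ (su n) x y :=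
  haveI := isSimple_su n hN
  B12Schur433.exists_eq_mul_killingForm_of_killing_neg (fun _ hx => killingForm_su_apply_self_neg hx) Φ hΦ

/-- The centroid of `𝔰𝔲(N)` (`N ≥ 2`) is scalar (v1.1) — the `hcen` binder of
`B12Schur433.hessian_chart_eq_sum_scalar_kernel_killing` at `𝔤 = 𝔰𝔲(N)`. [cite: Balaban1987RG1, (4.33)–(4.34) pp.289–290] -/
theorem centroid_eq_smul_su (hN : 1 < Fintype.card n) (φ : su n →ₗ[ℝ] su n) (hφ : ∀ x y : su n, φ ⁅x, y⁆ = ⁅x, φ y⁆) :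
    ∃ c : ℝ, ∀ x, φ x = c • x :=
  haveI := isSimple_su n hN
  B12Schur433.exists_eq_smul_of_centroid_of_killing_neg (fun _ hx => killingForm_su_apply_self_neg hx) φ hφ

end Schur

/-! ## §7 `B10Eq32SuN` §3 (G-form, abstract semisimple `𝔥 ⊆ 𝔸`) AT `𝔥 = 𝔰𝔩(N, ℂ) ⊂ M_N(ℂ)` -/

section B10

open Metric Set NormedSpace
open scoped Matrix.Norms.L2Operator
open B10Eq61PerSite (diffAlongV)
open B10Eq29TubeLine (TubeCfg expLine cstarAlgebraMatrix)

variable (N : ℕ) {D : LocDomainSys} {ι : Type*} [Fintype ι]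
  {sp' sp : D.Dom → Set (ι → Matrix (Fin N) (Fin N) ℂ)} {E : D.Dom → (ι → Matrix (Fin N) (Fin N) ℂ) → ℂ}
  {gen : D.Dom → (ι → Matrix (Fin N) (Fin N) ℂ) → ι → Matrix (Fin N) (Fin N) ℂ} {nX : D.Dom → ℕ}

/-- **`B10Eq32SuN.logHalfBound_expLine_of_semisimple` (REAL BACKGROUND, `G`-FORM) AT `𝔥 = 𝔰𝔩(N, ℂ)`** — the instance
hypotheses `[FiniteDimensional ℂ 𝔥] [LieAlgebra.IsSemisimple ℂ 𝔥]` of the abstract §3 (HONEST SCOPE (iv) there: «for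
`𝔥 = 𝔰𝔩_N` granted semisimplicity of `𝔰𝔩_N`, `N ≥ 2`, which is not available in Mathlib and not proved here»)
DISCHARGED by `SpecialLinearKilling.instIsSemisimpleSl`; `λ : Λ → 𝔰𝔩(N, ℂ)` any ℂ-spanning family, bond generators
skew-adjoint and TRACELESS.  Constant `8((p + q)/a)²·B`, rate `r − 2` (the numbers of the file of record).
[cite: Balaban1985UV3, (26), (28)–(29) p.263, (31)–(32) p.264, (61) p.271, p.272] -/
theorem logHalfBound_expLine_of_sl {B r a p q : ℝ} (ha : 0 < a) (hp : 0 ≤ p) (hq : 0 ≤ q) (hpq : 0 < p + q)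
    (hB : 0 ≤ B) {Λ : Type*} (lam : Λ → sl (Fin N) ℂ) (hlam : Submodule.span ℂ (Set.range lam) = ⊤) :
    letI := cstarAlgebraMatrix N
    ∀ (_hskew : ∀ X φ, φ ∈ sp' X → ∀ b, gen X φ b ∈ skewAdjoint (Matrix (Fin N) (Fin N) ℂ))
      (_hbound : ∀ X φ, φ ∈ sp' X → ∀ b, ‖gen X φ b‖ ≤ p + q * (1 + D.dj X))
      (_hsp : ∀ X, TubeCfg ι (Matrix (Fin N) (Fin N) ℂ) a ⊆ sp X) (_hE : ∀ X, DifferentiableOn ℂ (E X) (sp X))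
      (_hcl : ∀ X l (t : ℝ), ∀ V ∈ TubeCfg ι (Matrix (Fin N) (Fin N) ℂ) a,
        E X (fun b => exp ((t : ℂ) • (lam l : Matrix (Fin N) (Fin N) ℂ)) * V b *
          exp ((t : ℂ) • (-(lam l : Matrix (Fin N) (Fin N) ℂ)))) = E X V)
      (_htr : ∀ X φ, φ ∈ sp' X → ∀ b, Matrix.trace (gen X φ b) = 0)
      (_hEb : B13.LogHalfBound D sp E nX B r),
    B13.LogHalfBound D sp' (diffAlongV E (expLine gen (fun _ _ _ => 1))) nX (8 * ((p + q) / a) ^ 2 * B) (r - 2) := by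
  letI := cstarAlgebraMatrix N
  intro hskew hbound hsp hE hcl htr hEb
  exact B10Eq32SuN.logHalfBound_expLine_of_semisimple ha hp hq hpq hB hskew hbound hsp hE (sl (Fin N) ℂ) lam hlam hcl
    (fun X φ hφ b => htr X φ hφ b) hEb

end B10

end Literature.MathematicalPhysics.QuantumFieldTheory.Balaban1983to89.B12SemisimpleSuN
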